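import Summits.RiemannHypothesis.RiemannHypothesis.Theorems.WeilGroundStateGroundStatesConvergeToXiZeroSideEulerLagrange
import Literature.NumberTheory.LFunctions.ZetaZerosJensen
import Literature.NumberTheory.LFunctions.WeilGroundState
import Literature.Analysis.Calculus.SmoothCutoff
import Mathlib.Analysis.Complex.RealDeriv
import HarnessLib

/-!
# Stub `stub_interpolation_of_RH` of the line `Sketch`
(crux `WeilGroundState.GroundStatesConvergeToXi`, item stmt-RiemannHypothesis-1527, rev L8b)

**Sinc interpolation of Weil ground states under RH.**  For a ground state `u` at the window `a`
and every `s : ℂ`: `ε(a) û(s) = Σ_ρ m(ρ) û(ρ) K_a(s - ρ)`, `K_a(w) = ∫_{[-a,a]} e^{wx} dx`, the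
sum over the non-trivial zeros converging absolutely.  Proof: the zero-side Euler–Lagrange
equation under RH (`hasSum_zeroSide_eulerLagrange_of_riemannHypothesis`),
`Σ_ρ m(ρ) û(ρ) conj ĥ(ρ) = ε(a) ∫ u conj h`, is tested against `hₙ(t) = χₙ(t) e^{(conj s - 1/2)t}`
with the smooth plateau cut-offs `χₙ(t) = cutoff (n a - 1) (n t)` (`= 1` for `|t| ≤ a - 2/n`,
`= 0` for `|t| ≥ a - 1/n`); `conj ĥₙ(ρ) = ∫ χₙ e^{(s-ρ)t} → K_a(s - ρ)` and `∫ u conj hₙ → û(s)` by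
dominated convergence, and Tannery's theorem applies in `ρ`: one integration by parts
(`weilMellin_deriv`) gives `‖∫ χₙ e^{wt}‖ ≤ 4 D e^{a|Re w|}/‖w‖` uniformly in `n`, a majorant summable
by `Σ m ‖û(ρ)‖² ≤ ε(a)` (c4) and `Σ m(ρ)/‖ρ‖² < ∞` (`summable_zeroOrder_div_norm_sq`).  Tree + Mathlib only.
-/

set_option linter.dupNamespace false

noncomputable section

open MeasureTheory Complex Filter Set
open scoped Real Topology ComplexConjugate ContDiff

namespace Summit.RiemannHypothesis.RiemannHypothesis.Theorems.GroundStatesConvergeToXi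

open Literature.NumberTheory.LFunctions Literature.Analysis.Calculus

/-- `x t ≤ a |x|` for `|t| ≤ a`. [folklore] -/
theorem interpolation_mul_le_abs {x t a : ℝ} (h : |t| ≤ a) : x * t ≤ a * |x| :=
  calc x * t ≤ |x * t| := le_abs_self _
    _ = |x| * |t| := abs_mul _ _
    _ ≤ |x| * a := mul_le_mul_of_nonneg_left h (abs_nonneg _)
    _ = a * |x| := mul_comm _ _

/-- Off `[-a, a]` one has `a ≤ |t|`. [folklore] -/
theorem interpolation_le_abs_of_notMem_Icc {a t : ℝ} (h : t ∉ Icc (-a) a) : a ≤ |t| := by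
  rw [mem_Icc, not_and_or, not_le, not_le] at h
  rcases h with h | h
  · linarith [neg_abs_le t]
  · linarith [le_abs_self t]

/-- AM–GM step of the majorant: `m U P ≤ K (m U² + m/d²)` when `P d ≤ 2K`. [folklore] -/
theorem interpolation_amgm {m U P d K : ℝ} (hm : 0 ≤ m) (hU : 0 ≤ U) (hd : 0 < d) (hK : 0 ≤ K)
    (hP : P * d ≤ 2 * K) : m * (U * P) ≤ K * (m * U ^ 2 + m / d ^ 2) := by
  have h1 : P ≤ 2 * K / d := by rwa [le_div_iff₀ hd]
  calc m * (U * P) ≤ m * (U * (2 * K / d)) := by gcongr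
    _ = K * (m * (2 * U * d⁻¹)) := by rw [div_eq_mul_inv]; ring
    _ ≤ K * (m * (U ^ 2 + d⁻¹ ^ 2)) := by gcongr; exact two_mul_le_add_sq _ _
    _ = K * (m * U ^ 2 + m / d ^ 2) := by ring

/-- Crude bound `‖∫ χ(t) e^{wt} dt‖ ≤ 2a e^{a|Re w|}` for `0 ≤ χ ≤ 1` vanishing for `|t| ≥ a`.
[folklore] -/
theorem interpolation_norm_integral_ofReal_mul_cexp_le {χ : ℝ → ℝ} {a : ℝ} (ha : 0 ≤ a)
    (h0 : ∀ t, 0 ≤ χ t) (h1 : ∀ t, χ t ≤ 1) (hz : ∀ t, a ≤ |t| → χ t = 0) (w : ℂ) :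
    ‖∫ t : ℝ, (χ t : ℂ) * cexp (w * t)‖ ≤ 2 * a * Real.exp (a * |w.re|) := by
  rw [← setIntegral_eq_integral_of_forall_compl_eq_zero (s := Icc (-a) a) fun t ht ↦ by
    rw [hz t (interpolation_le_abs_of_notMem_Icc ht), Complex.ofReal_zero, zero_mul]]
  have hb : ∀ t ∈ Icc (-a) a, ‖(χ t : ℂ) * cexp (w * t)‖ ≤ Real.exp (a * |w.re|) := fun t ht ↦ by
    rw [norm_mul, Complex.norm_real, Real.norm_of_nonneg (h0 t), Complex.norm_exp,
      show (w * (t : ℂ)).re = w.re * t by simp [Complex.mul_re]]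
    exact (mul_le_mul (h1 t) (Real.exp_le_exp.2 (interpolation_mul_le_abs (abs_le.2 ⟨ht.1, ht.2⟩)))
      (Real.exp_pos _).le zero_le_one).trans_eq (one_mul _)
  calc ‖∫ t in Icc (-a) a, (χ t : ℂ) * cexp (w * t)‖
      ≤ Real.exp (a * |w.re|) * volume.real (Icc (-a) a) :=
        norm_setIntegral_le_of_norm_le_const measure_Icc_lt_top hb
    _ = 2 * a * Real.exp (a * |w.re|) := by rw [Real.volume_real_Icc_of_le (by linarith)]; ring

/-- **Integration by parts**: `‖w ∫ χ(t) e^{wt} dt‖ ≤ ∫ |χ'(t)| e^{Re w · t} dt` for a smooth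
compactly supported real `χ` (`weilMellin_deriv` for the test function `t ↦ (χ t : ℂ)`). [folklore] -/
theorem interpolation_norm_mul_integral_le {χ : ℝ → ℝ} (hχ : ContDiff ℝ ∞ χ)
    (hχc : HasCompactSupport χ) (w : ℂ) :
    ‖w * ∫ t : ℝ, (χ t : ℂ) * cexp (w * t)‖ ≤ ∫ t : ℝ, |deriv χ t| * Real.exp (w.re * t) := by
  have hG : IsWeilTest (fun t : ℝ ↦ (χ t : ℂ)) :=
    ⟨Complex.ofRealCLM.contDiff.comp hχ, hχc.comp_left Complex.ofReal_zero⟩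
  have hd : deriv (fun t : ℝ ↦ (χ t : ℂ)) = fun t ↦ ((deriv χ t : ℝ) : ℂ) :=
    funext fun t ↦ ((hχ.differentiable (by simp)) t).hasDerivAt.ofReal_comp.deriv
  have key := weilMellin_deriv hG (w + 1 / 2)
  simp only [weilMellin, hd, add_sub_cancel_right] at key
  rw [show w * ∫ t : ℝ, (χ t : ℂ) * cexp (w * t) =
      -∫ t : ℝ, ((deriv χ t : ℝ) : ℂ) * cexp (w * t) by rw [key]; ring, norm_neg]
  refine (norm_integral_le_integral_norm _).trans (le_of_eq (integral_congr_ae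
    (Eventually.of_forall fun t ↦ ?_)))
  have hre : (w * (t : ℂ)).re = w.re * t := by simp [Complex.mul_re]
  simp only [norm_mul, Complex.norm_real, Real.norm_eq_abs, Complex.norm_exp, hre]

/-- Chain rule for the rescaled cut-off. [folklore] -/
theorem interpolation_hasDerivAt_cutoff_comp_mul (R c t : ℝ) :
    HasDerivAt (fun t : ℝ ↦ cutoff R (c * t)) (c * deriv (cutoff R) (c * t)) t := by
  have h1 : HasDerivAt (cutoff R) (deriv (cutoff R) (c * t)) (c * t) :=
    ((contDiff_cutoff R (n := 1)).differentiable (by simp) _).hasDerivAt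
  have h2 : HasDerivAt (fun t : ℝ ↦ c * t) c t := by simpa using (hasDerivAt_id t).const_mul c
  exact (h1.comp t h2).congr_deriv (by ring)

/-- The rescaled cut-off vanishes for `|t| ≥ a`. [folklore] -/
theorem interpolation_cutoffSeq_eq_zero {a t : ℝ} (n : ℕ) (ht : a ≤ |t|) :
    cutoff (n * a - 1) (n * t) = 0 :=
  cutoff_eq_zero (by rw [abs_mul, Nat.abs_cast]; nlinarith [Nat.cast_nonneg (α := ℝ) n])

/-- The rescaled cut-off is eventually `1` at every `|t| < a`. [folklore] -/
theorem interpolation_eventually_cutoffSeq_eq_one {a t : ℝ} (ht : |t| < a) :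
    ∀ᶠ n : ℕ in atTop, cutoff (n * a - 1) (n * t) = 1 := by
  have h1 : ∀ᶠ n : ℕ in atTop, (2 : ℝ) / n < a - |t| :=
    (tendsto_const_div_atTop_nhds_zero_nat 2).eventually (gt_mem_nhds (sub_pos.2 ht))
  filter_upwards [h1, eventually_gt_atTop 0] with n hn hn0
  rw [div_lt_iff₀ (Nat.cast_pos.2 hn0)] at hn
  refine cutoff_eq_one ?_
  rw [abs_mul, Nat.abs_cast]
  nlinarith

/-- The rescaled cut-off is smooth. [folklore] -/
theorem interpolation_contDiff_cutoffSeq (a : ℝ) (n : ℕ) :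
    ContDiff ℝ ∞ fun t : ℝ ↦ cutoff (n * a - 1) (n * t) :=
  (contDiff_cutoff _).comp (contDiff_const.mul contDiff_id)

/-- `t ↦ χₙ(t) e^{ct}` is continuous. [folklore] -/
theorem interpolation_continuous_cutoffSeq_mul_cexp (a : ℝ) (n : ℕ) (c : ℂ) :
    Continuous fun t : ℝ ↦ ((cutoff (n * a - 1) (n * t) : ℝ) : ℂ) * cexp (c * t) :=
  (Complex.continuous_ofReal.comp (interpolation_contDiff_cutoffSeq a n).continuous).mul
    (by fun_prop)

/-- **Uniform total-variation bound**: with `|cutoff'| ≤ D` (uniformly in the plateau),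
`∫ |χ'(t)| e^{Re w · t} dt ≤ 4 D e^{a|Re w|}` for `χ(t) = cutoff (c a - 1) (c t)`, `c > 0`
(`χ'` is bounded by `c D` and vanishes off `[-a, -a + 2/c] ∪ [a - 2/c, a]`). [folklore] -/
theorem interpolation_integral_abs_deriv_cutoffSeq_le {D : ℝ} (hD : ∀ R y, |deriv (cutoff R) y| ≤ D)
    (a : ℝ) {c : ℝ} (hc : 0 < c) (w : ℂ) :
    ∫ t : ℝ, |deriv (fun t : ℝ ↦ cutoff (c * a - 1) (c * t)) t| * Real.exp (w.re * t) ≤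
      4 * D * Real.exp (a * |w.re|) := by
  set R : ℝ := c * a - 1 with hR
  set E : ℝ := Real.exp (a * |w.re|) with hE
  have hE0 : 0 < E := Real.exp_pos _
  set f : ℝ → ℝ := fun t ↦ |deriv (fun t : ℝ ↦ cutoff R (c * t)) t| * Real.exp (w.re * t)
    with hf
  have hf' : ∀ t, f t = c * |deriv (cutoff R) (c * t)| * Real.exp (w.re * t) := fun t ↦ by
    simp only [hf, (interpolation_hasDerivAt_cutoff_comp_mul R c t).deriv, abs_mul, abs_of_pos hc]
  have hD0 : 0 ≤ D := (abs_nonneg _).trans (hD 0 0)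
  have hca : ∀ t : ℝ, |c * t| = c * |t| := fun t ↦ by rw [abs_mul, abs_of_pos hc]
  -- `f` vanishes for `|t| ≥ a` and for `|t| < a - 2/c`, and `0 ≤ f ≤ c D E`
  have hbig : ∀ t, a ≤ |t| → f t = 0 := fun t ht ↦ by
    rw [hf', deriv_cutoff_eq_zero_of_le (by rw [hca]; nlinarith), abs_zero, mul_zero, zero_mul]
  have hsmall : ∀ t, |t| < a - 2 / c → f t = 0 := fun t ht ↦ by
    have hlt := mul_lt_mul_of_pos_left ht hc
    rw [mul_sub, mul_div_cancel₀ _ hc.ne'] at hlt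
    rw [hf', deriv_cutoff_eq_zero_of_lt (by rw [hca, hR]; linarith), abs_zero, mul_zero, zero_mul]
  have hle : ∀ t, ‖f t‖ ≤ c * D * E := fun t ↦ by
    rw [Real.norm_of_nonneg (by rw [hf']; positivity)]
    rcases le_or_gt a |t| with h | h
    · rw [hbig t h]; positivity
    · rw [hf']
      exact mul_le_mul (mul_le_mul_of_nonneg_left (hD R _) hc.le)
        (Real.exp_le_exp.2 (interpolation_mul_le_abs h.le)) (Real.exp_pos _).le (by positivity)
  set S : Set ℝ := Icc (-a) (-a + 2 / c) ∪ Icc (a - 2 / c) a with hS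
  have hoff : ∀ t, t ∉ S → f t = 0 := fun t ht ↦ by
    rcases le_or_gt a |t| with h | h
    · exact hbig t h
    · simp only [hS, mem_union, mem_Icc, not_or, not_and_or, not_le] at ht
      rw [abs_lt] at h
      exact hsmall t (abs_lt.2 ⟨by rcases ht.1 with h1 | h1 <;> linarith [h.1],
        by rcases ht.2 with h2 | h2 <;> linarith [h.2]⟩)
  have hSvol : volume.real S ≤ 4 / c := by
    have h2 : 0 < 2 / c := div_pos two_pos hc
    refine (measureReal_union_le _ _).trans_eq ?_
    rw [Real.volume_real_Icc_of_le (by linarith), Real.volume_real_Icc_of_le (by linarith)]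
    ring
  calc ∫ t, f t = ∫ t in S, f t := (setIntegral_eq_integral_of_forall_compl_eq_zero hoff).symm
    _ ≤ ‖∫ t in S, f t‖ := Real.le_norm_self _
    _ ≤ c * D * E * volume.real S := norm_setIntegral_le_of_norm_le_const
        (measure_union_lt_top measure_Icc_lt_top measure_Icc_lt_top) fun t _ ↦ hle t
    _ ≤ c * D * E * (4 / c) := mul_le_mul_of_nonneg_left hSvol (by positivity)
    _ = 4 * D * E * (c * c⁻¹) := by rw [div_eq_mul_inv]; ring
    _ = 4 * D * E := by rw [mul_inv_cancel₀ hc.ne', mul_one]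

/-- `t ↦ χ(t) e^{ct}` is a test function supported in `[-a, a]` when `χ` is smooth and vanishes
for `|t| ≥ a`. [folklore] -/
theorem interpolation_isWeilTest_ofReal_mul_cexp {χ : ℝ → ℝ} {a : ℝ} (hχ : ContDiff ℝ ∞ χ)
    (hz : ∀ t, a ≤ |t| → χ t = 0) (c : ℂ) :
    IsWeilTest (fun t : ℝ ↦ (χ t : ℂ) * cexp (c * t)) ∧
      tsupport (fun t : ℝ ↦ (χ t : ℂ) * cexp (c * t)) ⊆ Icc (-a) a := by
  have hzero : ∀ t, t ∉ Icc (-a) a → (χ t : ℂ) * cexp (c * t) = 0 := fun t ht ↦ by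
    rw [hz t (interpolation_le_abs_of_notMem_Icc ht), Complex.ofReal_zero, zero_mul]
  refine ⟨⟨(Complex.ofRealCLM.contDiff.comp hχ).mul
    (Complex.contDiff_exp.comp (contDiff_const.mul Complex.ofRealCLM.contDiff)),
    HasCompactSupport.intro isCompact_Icc hzero⟩, ?_⟩
  exact closure_minimal (fun t ht ↦ of_not_not fun h ↦ ht (hzero t h)) isClosed_Icc

/-- Conjugating the window test: `conj (r e^{(conj s - 1/2)t}) = r e^{(s - 1/2)t}`. [folklore] -/
theorem interpolation_conj_ofReal_mul_cexp (r t : ℝ) (s : ℂ) :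
    conj ((r : ℂ) * cexp ((conj s - 1 / 2) * t)) = r * cexp ((s - 1 / 2) * t) := by
  simp only [map_mul, ← Complex.exp_conj, map_sub, map_div₀, map_one, map_ofNat,
    Complex.conj_ofReal, Complex.conj_conj]

/-- `conj ((χ e^{(conj s - 1/2)·})^(σ)) = ∫ χ(t) e^{(s + conj σ - 1)t} dt` for real `χ`. [folklore] -/
theorem interpolation_conj_weilMellin (χ : ℝ → ℝ) (s σ : ℂ) :
    conj (weilMellin (fun t : ℝ ↦ (χ t : ℂ) * cexp ((conj s - 1 / 2) * t)) σ) =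
      ∫ t : ℝ, (χ t : ℂ) * cexp ((s + conj σ - 1) * t) := by
  rw [weilMellin, ← integral_conj]
  refine integral_congr_ae (Eventually.of_forall fun t ↦ ?_)
  simp only [map_mul, ← Complex.exp_conj, map_sub, map_div₀, map_one, map_ofNat,
    Complex.conj_ofReal, Complex.conj_conj]
  rw [mul_assoc, ← Complex.exp_add]
  congr 2
  ring

/-- **Dominated convergence against the cut-offs**: `∫ v χₙ e^{ct} → ∫_{[-a,a]} v e^{ct}` for `v`
a.e.-strongly measurable with `v e^{ct}` integrable on the window (`|χₙ| ≤ 1`, `χₙ = 0` off the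
window, `χₙ → 1` inside it off the null set `{±a}`). [folklore] -/
theorem interpolation_tendsto_integral_mul_cutoffSeq {a : ℝ} {v : ℝ → ℂ} (c : ℂ)
    (hv : AEStronglyMeasurable v volume)
    (hi : IntegrableOn (fun t : ℝ ↦ v t * cexp (c * t)) (Icc (-a) a)) :
    Tendsto (fun n : ℕ ↦ ∫ t : ℝ, v t * (((cutoff (n * a - 1) (n * t) : ℝ) : ℂ) * cexp (c * t)))
      atTop (𝓝 (∫ t in Icc (-a) a, v t * cexp (c * t))) := by
  have hae : ∀ᵐ t : ℝ, t ∉ ({a, -a} : Set ℝ) :=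
    measure_eq_zero_iff_ae_notMem.1 (((Set.finite_singleton (-a)).insert a).measure_zero volume)
  rw [← integral_indicator measurableSet_Icc]
  refine tendsto_integral_of_dominated_convergence
    (fun t ↦ (Icc (-a) a).indicator (fun t ↦ ‖v t * cexp (c * t)‖) t)
    (fun n ↦ hv.mul (interpolation_continuous_cutoffSeq_mul_cexp a n _).aestronglyMeasurable)
    (IntegrableOn.integrable_indicator hi.norm measurableSet_Icc)
    (fun n ↦ Eventually.of_forall fun t ↦ ?_) ?_
  · by_cases ht : t ∈ Icc (-a) a
    · rw [indicator_of_mem ht, norm_mul, norm_mul, norm_mul, Complex.norm_real,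
        Real.norm_of_nonneg (cutoff_nonneg _ _)]
      exact mul_le_mul_of_nonneg_left
        (mul_le_of_le_one_left (norm_nonneg _) (cutoff_le_one _ _)) (norm_nonneg _)
    · rw [indicator_of_notMem ht, interpolation_cutoffSeq_eq_zero n
        (interpolation_le_abs_of_notMem_Icc ht), Complex.ofReal_zero, zero_mul, mul_zero, norm_zero]
  · filter_upwards [hae] with t h2
    by_cases ht : |t| < a
    · rw [indicator_of_mem (mem_Icc.2 ⟨(abs_lt.1 ht).1.le, (abs_lt.1 ht).2.le⟩)]
      refine tendsto_const_nhds.congr' ?_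
      filter_upwards [interpolation_eventually_cutoffSeq_eq_one ht] with n hn
      simp only [hn, Complex.ofReal_one, one_mul]
    · have hta : t ∉ Icc (-a) a := fun h ↦ by
        simp only [mem_insert_iff, mem_singleton_iff, not_or] at h2
        exact ht (abs_lt.2 ⟨lt_of_le_of_ne h.1 (Ne.symm h2.2), lt_of_le_of_ne h.2 h2.1⟩)
      rw [indicator_of_notMem hta]
      simp only [interpolation_cutoffSeq_eq_zero _ (interpolation_le_abs_of_notMem_Icc hta),
        Complex.ofReal_zero, zero_mul, mul_zero]
      exact tendsto_const_nhds

/-- Under RH, `Σ_ρ m(ρ)/‖s - ρ‖² < ∞` over the non-trivial zeros, for every `s : ℂ`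
(`summable_zeroOrder_div_norm_sq` over the zeros with `Re ρ ≥ 1/4`, which under RH contain all
non-trivial zeros; and `‖s - ρ‖ ≥ ‖ρ‖/2` for all but finitely many `ρ`). [folklore] -/
theorem interpolation_summable_order_div_norm_sub_sq (hRH : RiemannHypothesis) (s : ℂ) :
    Summable fun ρ : ZetaZeros.riemannZetaNontrivialZeros ↦
      (riemannZetaZeroOrder (ρ : ℂ) : ℝ) / ‖s - (ρ : ℂ)‖ ^ 2 := by
  have hmem : ∀ ρ : ZetaZeros.riemannZetaNontrivialZeros, (ρ : ℂ) ∈ zetaZerosRight := fun ρ ↦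
    ⟨ZetaZeros.riemannZetaNontrivialZeros.zeta_eq_zero ρ.2,
      by rw [SoundTest.re_eq_half_of_RH hRH ρ]; norm_num⟩
  have hinj : Function.Injective (fun ρ : ZetaZeros.riemannZetaNontrivialZeros ↦
      (⟨(ρ : ℂ), hmem ρ⟩ : zetaZerosRight)) :=
    fun ρ ρ' h ↦ Subtype.ext (congrArg (fun x : zetaZerosRight ↦ (x : ℂ)) h)
  have h0 : Summable fun ρ : ZetaZeros.riemannZetaNontrivialZeros ↦
      (riemannZetaZeroOrder (ρ : ℂ) : ℝ) / ‖(ρ : ℂ)‖ ^ 2 := by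
    have h := summable_zeroOrder_div_norm_sq.comp_injective hinj
    simpa only [Function.comp_def] using h
  refine Summable.of_norm_bounded_eventually (h0.mul_left 4) (Filter.eventually_cofinite.2 ?_)
  refine ((riemannZetaNontrivialZeros_finite_inter_ball 0 (2 * ‖s‖)).preimage
    Subtype.val_injective.injOn).subset fun ρ hρ ↦ ⟨ρ.2, ?_⟩
  rw [Metric.mem_ball, dist_zero_right]
  by_contra hge
  apply hρ
  have hm : (0 : ℝ) ≤ riemannZetaZeroOrder (ρ : ℂ) := by
    exact_mod_cast riemannZetaZeroOrder_nonneg (ZetaZeros.riemannZetaNontrivialZeros.ne_one ρ.2)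
  have hρ0 : 0 < ‖(ρ : ℂ)‖ :=
    (ZetaZeros.riemannZetaNontrivialZeros.re_pos ρ.2).trans_le (Complex.re_le_norm _)
  have hd : ‖(ρ : ℂ)‖ / 2 ≤ ‖s - (ρ : ℂ)‖ := by
    have := norm_sub_norm_le (ρ : ℂ) s
    rw [norm_sub_rev] at this
    linarith [not_lt.1 hge]
  rw [Real.norm_of_nonneg (div_nonneg hm (sq_nonneg _)),
    show 4 * ((riemannZetaZeroOrder (ρ : ℂ) : ℝ) / ‖(ρ : ℂ)‖ ^ 2) =
      (riemannZetaZeroOrder (ρ : ℂ) : ℝ) / (‖(ρ : ℂ)‖ / 2) ^ 2 by field_simp; ring]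
  exact div_le_div_of_nonneg_left hm (by positivity) (by gcongr)

/-- **Stub `stub_interpolation_of_RH` (exponential-tested Euler–Lagrange identity under RH).**
For a Weil ground state `u` at the window `a` and every `s : ℂ`, under RH
`Σ_ρ m(ρ) û(ρ) ∫_{[-a,a]} e^{(s-ρ)x} dx = ε(a) û(s)`, the sum over the non-trivial zeros of `ζ`
converging absolutely (`hasSum_zeroSide_eulerLagrange_of_riemannHypothesis` against smooth cut-offs of
`1_{[-a,a]} e^{(conj s - 1/2)t}`; dominated convergence in `t`, Tannery in `ρ`). [folklore] -/
theorem stub_interpolation_of_RH :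
    RiemannHypothesis → ∀ (a : ℝ) (u : ℝ → ℂ) (s : ℂ), IsWeilGroundState a u →
      HasSum (fun ρ : ZetaZeros.riemannZetaNontrivialZeros =>
          (riemannZetaZeroOrder (ρ : ℂ) : ℂ) *
            (weilMellin u ρ * ∫ x in Set.Icc (-a) a, cexp ((s - (ρ : ℂ)) * x)))
        ((weilGroundEnergy a : ℂ) * weilMellin u s) := by
  intro hRH a u s hu
  classical
  obtain ⟨D, hD0, hD⟩ := exists_bound_deriv_cutoff
  set E : ℝ := Real.exp (a * |s.re - 1 / 2|) with hE
  have hE0 : 0 < E := Real.exp_pos _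
  have hRe : ∀ ρ : ZetaZeros.riemannZetaNontrivialZeros, (s - (ρ : ℂ)).re = s.re - 1 / 2 := fun ρ ↦ by
    rw [sub_re, SoundTest.re_eq_half_of_RH hRH ρ]
  -- `P n w = ∫ χₙ(t) e^{wt} dt`, the terms `T n ρ = m(ρ) û(ρ) P n (s - ρ)` and their limits `Tu ρ`
  set P : ℕ → ℂ → ℂ := fun n w ↦
    ∫ t : ℝ, ((cutoff (n * a - 1) (n * t) : ℝ) : ℂ) * cexp (w * t) with hP
  set T : ℕ → ZetaZeros.riemannZetaNontrivialZeros → ℂ := fun n ρ ↦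
    (riemannZetaZeroOrder (ρ : ℂ) : ℂ) * (weilMellin u ρ * P n (s - ρ)) with hT
  set Tu : ZetaZeros.riemannZetaNontrivialZeros → ℂ := fun ρ ↦ (riemannZetaZeroOrder (ρ : ℂ) : ℂ) *
    (weilMellin u ρ * ∫ x in Set.Icc (-a) a, cexp ((s - (ρ : ℂ)) * x)) with hTu
  -- Step 1: the Euler–Lagrange equation tested against `hₙ = χₙ e^{(conj s - 1/2)t}`
  have hEL : ∀ n : ℕ, HasSum (T n) ((weilGroundEnergy a : ℂ) *
      ∫ t : ℝ, u t * (((cutoff (n * a - 1) (n * t) : ℝ) : ℂ) * cexp ((s - 1 / 2) * t))) := by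
    intro n
    obtain ⟨hh, hhs⟩ := interpolation_isWeilTest_ofReal_mul_cexp
      (interpolation_contDiff_cutoffSeq a n) (fun t ↦ interpolation_cutoffSeq_eq_zero n)
      (conj s - 1 / 2)
    have h := hasSum_zeroSide_eulerLagrange_of_riemannHypothesis hRH hu hh hhs
    simp only [interpolation_conj_ofReal_mul_cexp] at h
    refine h.congr_fun fun ρ ↦ ?_
    simp only [hT, hP]
    rw [interpolation_conj_weilMellin, ← SoundTest.one_sub_eq_conj_of_RH hRH ρ,
      show s + (1 - (ρ : ℂ)) - 1 = s - ρ by ring]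
  -- Step 2: the two dominated-convergence limits
  have hlim : Tendsto (fun n : ℕ ↦ (weilGroundEnergy a : ℂ) *
      ∫ t : ℝ, u t * (((cutoff (n * a - 1) (n * t) : ℝ) : ℂ) * cexp ((s - 1 / 2) * t))) atTop
      (𝓝 ((weilGroundEnergy a : ℂ) * weilMellin u s)) := by
    have h := interpolation_tendsto_integral_mul_cutoffSeq (a := a) (s - 1 / 2) hu.memLp.1
      (hu.integrable_mul_cexp _).integrableOn
    rw [setIntegral_eq_integral_of_ae_compl_eq_zero
      (hu.ae_eq_zero_of_notMem.mono fun t ht hts ↦ by rw [ht hts, zero_mul])] at h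
    exact h.const_mul _
  have hterm : ∀ ρ : ZetaZeros.riemannZetaNontrivialZeros,
      Tendsto (fun n ↦ T n ρ) atTop (𝓝 (Tu ρ)) := fun ρ ↦ by
    have h := interpolation_tendsto_integral_mul_cutoffSeq (a := a) (s - ρ) aestronglyMeasurable_const
      ((by fun_prop : Continuous fun t : ℝ ↦ (1 : ℂ) * cexp ((s - ρ) * t)).integrableOn_Icc)
    simp only [one_mul] at h
    exact (h.const_mul (weilMellin u ρ)).const_mul _
  -- Step 3: the two bounds on `P n (s - ρ)`
  have hP1 (n : ℕ) (ρ : ZetaZeros.riemannZetaNontrivialZeros) : ‖P n (s - ρ)‖ ≤ 2 * a * E := by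
    have h := interpolation_norm_integral_ofReal_mul_cexp_le
      (χ := fun t ↦ cutoff (n * a - 1) (n * t)) hu.pos.le (fun t ↦ cutoff_nonneg _ _)
      (fun t ↦ cutoff_le_one _ _) (fun t ht ↦ interpolation_cutoffSeq_eq_zero n ht) (s - ρ)
    rwa [hRe] at h
  have hP2 (n : ℕ) (ρ : ZetaZeros.riemannZetaNontrivialZeros) (hn : 0 < n) :
      ‖(s - (ρ : ℂ)) * P n (s - ρ)‖ ≤ 4 * D * E :=
    calc ‖(s - (ρ : ℂ)) * P n (s - ρ)‖
        ≤ ∫ t : ℝ, |deriv (fun t : ℝ ↦ cutoff (n * a - 1) (n * t)) t| *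
            Real.exp ((s - (ρ : ℂ)).re * t) :=
          interpolation_norm_mul_integral_le (interpolation_contDiff_cutoffSeq a n)
            (HasCompactSupport.intro isCompact_Icc fun _ ht ↦
              interpolation_cutoffSeq_eq_zero n (interpolation_le_abs_of_notMem_Icc ht)) _
      _ ≤ 4 * D * Real.exp (a * |(s - (ρ : ℂ)).re|) :=
          interpolation_integral_abs_deriv_cutoffSeq_le hD a (Nat.cast_pos.2 hn) _
      _ = 4 * D * E := by rw [hRe]
  -- Step 4: the summable majorant (one-point correction at `ρ = s`)
  set bound : ZetaZeros.riemannZetaNontrivialZeros → ℝ := fun ρ ↦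
    2 * D * E * ((riemannZetaZeroOrder (ρ : ℂ) : ℝ) * ‖weilMellin u ρ‖ ^ 2 +
      (riemannZetaZeroOrder (ρ : ℂ) : ℝ) / ‖s - (ρ : ℂ)‖ ^ 2) +
    (if (ρ : ℂ) = s then 2 * a * E * ((riemannZetaZeroOrder (ρ : ℂ) : ℝ) * ‖weilMellin u ρ‖)
      else 0) with hbound
  have hfin : ({ρ : ZetaZeros.riemannZetaNontrivialZeros | (ρ : ℂ) = s} :
      Set ZetaZeros.riemannZetaNontrivialZeros).Finite :=
    Set.Subsingleton.finite fun ρ hρ ρ' hρ' ↦ Subtype.ext (hρ.trans hρ'.symm)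
  have hbound_summ : Summable bound :=
    (((summable_order_mul_norm_sq_weilMellin_of_riemannHypothesis hRH hu).1.add
      (interpolation_summable_order_div_norm_sub_sq hRH s)).mul_left (2 * D * E)).add
      (summable_of_hasFiniteSupport (hfin.subset fun ρ hρ ↦ of_not_not fun h ↦ hρ (if_neg h)))
  have hdom : ∀ᶠ n : ℕ in atTop, ∀ ρ, ‖T n ρ‖ ≤ bound ρ := by
    filter_upwards [eventually_gt_atTop 0] with n hn ρ
    have hm : (0 : ℝ) ≤ riemannZetaZeroOrder (ρ : ℂ) := by
      exact_mod_cast riemannZetaZeroOrder_nonneg (ZetaZeros.riemannZetaNontrivialZeros.ne_one ρ.2)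
    have hT' : ‖T n ρ‖ = (riemannZetaZeroOrder (ρ : ℂ) : ℝ) * (‖weilMellin u ρ‖ * ‖P n (s - ρ)‖) := by
      simp only [hT, norm_mul, Complex.norm_intCast, abs_of_nonneg hm]
    have h0 : 0 ≤ 2 * D * E * ((riemannZetaZeroOrder (ρ : ℂ) : ℝ) * ‖weilMellin u ρ‖ ^ 2 +
        (riemannZetaZeroOrder (ρ : ℂ) : ℝ) / ‖s - (ρ : ℂ)‖ ^ 2) :=
      mul_nonneg (by positivity) (add_nonneg (mul_nonneg hm (sq_nonneg _)) (div_nonneg hm (sq_nonneg _)))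
    rw [hT']
    by_cases hρs : (ρ : ℂ) = s
    · -- the (at most one) index `ρ = s`: crude bound
      have h1 := mul_le_mul_of_nonneg_left
        (mul_le_mul_of_nonneg_left (hP1 n ρ) (norm_nonneg (weilMellin u ρ))) hm
      simp only [hbound, if_pos hρs]
      linarith
    · -- `ρ ≠ s`: integration-by-parts bound and AM–GM
      have h1 := hP2 n ρ hn
      rw [norm_mul] at h1
      simp only [hbound, if_neg hρs, add_zero]
      exact interpolation_amgm hm (norm_nonneg _) (norm_pos_iff.2 (sub_ne_zero.2 (Ne.symm hρs)))
        (by positivity) (by linarith)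
  -- Step 5: Tannery and identification of the limits
  have hTann := tendsto_tsum_of_dominated_convergence hbound_summ hterm hdom
  have heq : ∑' ρ, Tu ρ = (weilGroundEnergy a : ℂ) * weilMellin u s :=
    tendsto_nhds_unique hTann (hlim.congr fun n ↦ (hEL n).tsum_eq.symm)
  have hTu_le : ∀ ρ, ‖Tu ρ‖ ≤ bound ρ := fun ρ ↦
    le_of_tendsto (hterm ρ).norm (hdom.mono fun n hn ↦ hn ρ)
  rw [← heq]
  exact (Summable.of_norm_bounded hbound_summ hTu_le).hasSum

end Summit.RiemannHypothesis.RiemannHypothesis.Theorems.GroundStatesConvergeToXi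

end
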